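import Literature.Geometry.Lorentzian.GaussEquationFrame
import Literature.Geometry.Lorentzian.ChartScalarCurvature
import Literature.Geometry.Lorentzian.MetricNormSq
import Literature.Geometry.Lorentzian.CurvatureSymmetries
import Literature.Geometry.Lorentzian.LeviCivitaCurvature
import HarnessLib

/-!
# The traced Gauss equation of an immersed surface in a three-manifold

For a semi-Riemannian hypersurface the Gauss equation (O'Neill 1983, Ch. 4, Thm. 5 and its
Corollary: `K(v, w) = K̄(v, w) + (⟨II(v,v), II(w,w)⟩ − ⟨II(v,w), II(v,w)⟩)/Q(v,w)`) traced twice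
over a surface `N²` in a three-manifold `M³` gives the identity used throughout the theory of
surfaces in `3`-manifolds (Huisken–Ilmanen 2001, §5; Schoen–Yau 1979, (2.14)):
`S_{f^*g} = S_g − 2 Rc_g(ν, ν)/ε + (H² − |K|²)/ε`, with `S` the scalar curvatures (`S_{f^*g} = 2×`
Gauss curvature), `ν` the unit normal of sign `ε`, `H` the mean curvature and `|K|²` the square
norm of the second fundamental form. This file proves it from the Gauss equation on a coordinate
pair (`gauss_equation_localFrame`, `GaussEquationFrame.lean`):

* `PseudoRiemannianMetric.scalarCurvature_inducedMetric_eq` — **the traced Gauss equation** for a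
  smooth spacelike immersion `f : N → M` with `dim N = 2`, `dim M = 3` and a unit normal field of
  sign `ε ≠ 0` with smooth lift.

Linear algebra of curvature in orthogonal frames (all proved):

* `scalarCurvature_eq_of_isOrthoᵢ_two` — in dimension two, `S = 2 g(R(β₀,β₁)β₁,β₀)/(a₀a₁)` for an
  orthogonal frame with `aₖ = g(βₖ,βₖ)` (O'Neill, Lemma 3.39, Def. 3.53);
* `scalarCurvature_sub_ricci_eq_of_isOrthoᵢ_three` — in dimension three,
  `S − 2Rc(β₂,β₂)/a₂ = 2 g(R(β₀,β₁)β₁,β₀)/(a₀a₁)`;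
* `gram_inv_of_isOrthoᵢ` (the inverse Gram matrix of an orthogonal frame is diagonal),
  `val_riemann_self₁₂`, `val_riemann_self₃₄`, `val_riemann_swap` (vanishing and symmetric
  curvature pairings, O'Neill Prop. 3.36).

Everything is proved; there are no definitions and no named facts.

## References

* B. O'Neill, *Semi-Riemannian geometry with applications to relativity*, Academic Press 1983,
  Ch. 3, Prop. 3.36, Lemma 3.39, Lemma 3.52, Def. 3.53; Ch. 4, Thm. 5 and Corollary (p. 100).
* G. Huisken, T. Ilmanen, *The inverse mean curvature flow and the Riemannian Penrose
  inequality*, J. Differential Geom. 59 (2001), §5 ("since `N_t` is a surface, by the Gauss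
  equation `2K = R − 2Rc(ν,ν) + H² − |A|²`").
-/

noncomputable section

open Bundle Set Filter Function Manifold
open scoped Manifold ContDiff Topology

namespace Literature.Geometry.Lorentzian

namespace PseudoRiemannianMetric

variable {E : Type*} [NormedAddCommGroup E] [NormedSpace ℝ E] {H : Type*} [TopologicalSpace H]
  {I : ModelWithCorners ℝ E H} {M : Type*} [TopologicalSpace M] [ChartedSpace H M]
  [IsManifold I ∞ M] [FiniteDimensional ℝ E] [CompleteSpace E]
  (g : PseudoRiemannianMetric I ∞ E (TangentSpace I : M → Type _)) [g.HasLeviCivita]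

/-! ### Curvature pairings that vanish -/

omit [FiniteDimensional ℝ E] [CompleteSpace E] in
/-- `g(R(X,X)Z, W) = 0` (antisymmetry in the first pair; O'Neill 1983, Ch. 3, Prop. 3.36 (1)).
[cite: ONeill1983, Ch. 3, Prop. 3.36 (1)] -/
theorem val_riemann_self₁₂ (x : M) (X₀ Z₀ W₀ : TangentSpace I x) :
    g.val x (g.riemann x X₀ X₀ Z₀) W₀ = 0 := by
  have h := val_curvature_antisymm (g := g) (cov := g.leviCivita) x X₀ X₀ Z₀ W₀
  change g.val x (g.riemann x X₀ X₀ Z₀) W₀ = -g.val x (g.riemann x X₀ X₀ Z₀) W₀ at h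
  linarith

/-- `g(R(X,Y)Z, Z) = 0` (skew-adjointness, O'Neill 1983, Ch. 3, Prop. 3.36 (2)).
[cite: ONeill1983, Ch. 3, Prop. 3.36 (2)] -/
theorem val_riemann_self₃₄ (x : M) (X₀ Y₀ Z₀ : TangentSpace I x) :
    g.val x (g.riemann x X₀ Y₀ Z₀) Z₀ = 0 := by
  have h := val_riemann_skew_of_facts (g := g) isLeviCivita_leviCivita_holds
    (isLocallyContMDiff_leviCivita_holds g) (by exact WithTop.coe_le_coe.2 le_top) x X₀ Y₀ Z₀ Z₀
  linarith

/-- `g(R(Y,X)X, Y) = g(R(X,Y)Y, X)` (antisymmetry in the first pair and skew-adjointness).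
O'Neill 1983, Ch. 3, Prop. 3.36 (1), (2). [cite: ONeill1983, Ch. 3, Prop. 3.36] -/
theorem val_riemann_swap (x : M) (X₀ Y₀ : TangentSpace I x) :
    g.val x (g.riemann x Y₀ X₀ X₀) Y₀ = g.val x (g.riemann x X₀ Y₀ Y₀) X₀ := by
  have h1 := val_curvature_antisymm (g := g) (cov := g.leviCivita) x Y₀ X₀ X₀ Y₀
  have h2 := val_riemann_skew_of_facts (g := g) isLeviCivita_leviCivita_holds
    (isLocallyContMDiff_leviCivita_holds g) (by exact WithTop.coe_le_coe.2 le_top) x X₀ Y₀ X₀ Y₀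
  change g.val x (g.riemann x Y₀ X₀ X₀) Y₀ = -g.val x (g.riemann x X₀ Y₀ X₀) Y₀ at h1
  linarith

/-! ### The inverse Gram matrix of an orthogonal basis -/

omit [FiniteDimensional ℝ E] [CompleteSpace E] [g.HasLeviCivita] in
/-- The Gram matrix of a `g_x`-orthogonal basis of non-null vectors is the diagonal matrix of the
`g(βᵢ, βᵢ)`, and its inverse is the diagonal matrix of their inverses. [folklore] -/
theorem gram_inv_of_isOrthoᵢ {ι : Type*} [Fintype ι] [DecidableEq ι] (x : M)
    (β : Module.Basis ι ℝ (TangentSpace I x)) (hβ : (g.toBilinForm x).IsOrthoᵢ β)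
    (hd : ∀ i, g.val x (β i) (β i) ≠ 0) :
    (Matrix.of fun i j ↦ g.val x (β i) (β j))⁻¹ =
      Matrix.diagonal fun i ↦ (g.val x (β i) (β i))⁻¹ := by
  have hG : (Matrix.of fun i j ↦ g.val x (β i) (β j)) =
      Matrix.diagonal fun i ↦ g.val x (β i) (β i) := by
    ext i j
    by_cases hij : i = j
    · subst hij; simp
    · rw [Matrix.of_apply, Matrix.diagonal_apply_ne _ hij]
      exact hβ hij
  rw [hG]
  refine Matrix.inv_eq_left_inv ?_
  rw [Matrix.diagonal_mul_diagonal, ← Matrix.diagonal_one]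
  congr 1
  funext i
  exact inv_mul_cancel₀ (hd i)

/-! ### Dimension two: scalar curvature from one curvature pairing -/

/-- **The scalar curvature of a surface in an orthogonal frame**: for a `g_x`-orthogonal basis
`(β₀, β₁)` of a two-dimensional tangent space with `g(βₖ, βₖ) ≠ 0`,
`S(x) = 2 g(R(β₀, β₁)β₁, β₀) / (g(β₀,β₀) g(β₁,β₁))` — i.e. `S = 2K` with `K` the sectional
(Gauss) curvature of the tangent plane (O'Neill 1983, Ch. 3, Lemma 3.39 and Def. 3.53 with
Lemma 3.52; the scalar and Ricci curvatures in a basis, `scalarCurvature_eq_sum`, `ricci_eq_sum`,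
the inverse Gram matrix of the orthogonal frame being diagonal).
[cite: ONeill1983, Ch. 3, Lemma 3.39 and Def. 3.53] -/
theorem scalarCurvature_eq_of_isOrthoᵢ_two (x : M) (β : Module.Basis (Fin 2) ℝ (TangentSpace I x))
    (hβ : (g.toBilinForm x).IsOrthoᵢ β) (h0 : g.val x (β 0) (β 0) ≠ 0)
    (h1 : g.val x (β 1) (β 1) ≠ 0) :
    g.scalarCurvature x =
      2 * g.val x (g.riemann x (β 0) (β 1) (β 1)) (β 0) /
        (g.val x (β 0) (β 0) * g.val x (β 1) (β 1)) := by
  rw [scalarCurvature_eq_sum g x β]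
  simp only [ricci_eq_sum g x β, gram_inv_of_isOrthoᵢ g x β hβ (by
    intro i; fin_cases i <;> assumption), Matrix.diagonal_apply, Fin.sum_univ_two, Fin.isValue,
    if_true, one_ne_zero, zero_ne_one, if_false, zero_mul,
    add_zero, zero_add, val_riemann_self₁₂, mul_zero, val_riemann_swap g x (β 0) (β 1)]
  field_simp
  ring

/-! ### Dimension three with a distinguished direction -/

/-- **Scalar curvature minus twice the normal Ricci curvature, in an adapted orthogonal frame**:
for a `g_x`-orthogonal basis `(β₀, β₁, β₂)` of a three-dimensional tangent space with non-null
vectors, `S(x) − 2 Ric(β₂, β₂)/g(β₂,β₂) = 2 g(R(β₀, β₁)β₁, β₀) / (g(β₀,β₀) g(β₁,β₁))` (twice the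
sectional curvature of the plane `β₂^⊥`): `S` is the sum over ordered pairs of the sectional
terms and `Ric(β₂,β₂)/g(β₂,β₂)` collects those through `β₂` (O'Neill 1983, Ch. 3, Lemma 3.52,
Def. 3.53 and Lemma 3.39; pair symmetry and antisymmetry of `R`).
[cite: ONeill1983, Ch. 3, Lemma 3.52 and Def. 3.53] -/
theorem scalarCurvature_sub_ricci_eq_of_isOrthoᵢ_three (x : M)
    (β : Module.Basis (Fin 3) ℝ (TangentSpace I x)) (hβ : (g.toBilinForm x).IsOrthoᵢ β)
    (h0 : g.val x (β 0) (β 0) ≠ 0) (h1 : g.val x (β 1) (β 1) ≠ 0)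
    (h2 : g.val x (β 2) (β 2) ≠ 0) :
    g.scalarCurvature x - 2 * g.ricci x (β 2) (β 2) / g.val x (β 2) (β 2) =
      2 * g.val x (g.riemann x (β 0) (β 1) (β 1)) (β 0) /
        (g.val x (β 0) (β 0) * g.val x (β 1) (β 1)) := by
  rw [scalarCurvature_eq_sum g x β]
  simp only [ricci_eq_sum g x β, gram_inv_of_isOrthoᵢ g x β hβ (by
    intro i; fin_cases i <;> assumption), Matrix.diagonal_apply, Fin.sum_univ_three,
    Fin.isValue, if_true, if_false, zero_mul, add_zero, zero_add,
    val_riemann_self₁₂, mul_zero, val_riemann_swap g x (β 0) (β 1),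
    val_riemann_swap g x (β 0) (β 2), val_riemann_swap g x (β 1) (β 2),
    show (1 : Fin 3) ≠ 0 from by decide, show (2 : Fin 3) ≠ 0 from by decide,
    show (2 : Fin 3) ≠ 1 from by decide, show (0 : Fin 3) ≠ 1 from by decide,
    show (0 : Fin 3) ≠ 2 from by decide, show (1 : Fin 3) ≠ 2 from by decide]
  field_simp
  ring


/-! ### The traced Gauss equation of a surface in a three-manifold -/

section Traced

variable {E' : Type*} [NormedAddCommGroup E'] [NormedSpace ℝ E'] {H' : Type*} [TopologicalSpace H']
  {I' : ModelWithCorners ℝ E' H'} {N : Type*} [TopologicalSpace N] [ChartedSpace H' N]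
  [IsManifold I' ∞ N] [FiniteDimensional ℝ E'] [CompleteSpace E'] [I'.Boundaryless] {f : N → M}
  (hpb : contMDiff_pullbackBilin I M I' N ∞) (hfi : g.IsSpacelikeImmersion I' f)
  {ν : NormalField I f} {ε : ℝ}

/-- **The traced Gauss equation of an immersed surface in a three-manifold** (O'Neill 1983,
Ch. 4, Thm. 5 and its Corollary, traced twice; Huisken–Ilmanen 2001, §5: "by the Gauss equation,
`2K = R − 2Rc(ν,ν) + H² − |A|²`"). For a smooth spacelike immersion `f : (N², f^*g) → (M³, g)`
with unit normal field `ν` of sign `ε ≠ 0` (smooth lift) and every `y₀`: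
`S_{f^*g}(y₀) = S_g(f y₀) − 2 Rc_g(ν, ν)/ε + (H² − |K|²_{f^*g})/ε`, where `S` are the scalar
curvatures, `H = tr_{f^*g} K` the mean curvature and `|K|²` the square norm of the second
fundamental form `K = secondFundamentalForm`. Proof: in a `(f^*g)`-orthogonal basis `(β₀, β₁)`
of `T_{y₀}N` (`exists_isOrthoᵢ_basis`), `S_{f^*g} = 2(f^*g)(R(β₀,β₁)β₁,β₀)/(a₀a₁)`
(`scalarCurvature_eq_of_isOrthoᵢ_two`), and in the `g`-orthogonal basis `(df β₀, df β₁, ν)` of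
`T_{f y₀}M`, `S_g − 2Rc(ν,ν)/ε = 2g(R̄(df β₀, df β₁)df β₁, df β₀)/(a₀a₁)`
(`scalarCurvature_sub_ricci_eq_of_isOrthoᵢ_three`), while `H = K₀₀/a₀ + K₁₁/a₁`,
`|K|² = ∑ K_{ij}²/(aᵢaⱼ)` (`normSq_eq_sum_sq`, `K` symmetric); the Gauss equation on the pair
`(β₀, β₁)` (`gauss_equation_localFrame`) links the two curvature pairings.
[cite: ONeill1983, Ch. 4, Thm. 5 and Corollary] -/
theorem scalarCurvature_inducedMetric_eq
    (hν : ContMDiff I' I.tangent ∞ (fun x ↦ (TotalSpace.mk' E (f x) (ν x) : TangentBundle I M)))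
    (hun : g.IsUnitNormal I' f ν ε) (hε : ε ≠ 0)
    (h2 : Module.finrank ℝ E' = 2) (h3 : Module.finrank ℝ E = 3) (y₀ : N) :
    haveI := (g.inducedMetric f hpb hfi).hasLeviCivita
    (g.inducedMetric f hpb hfi).scalarCurvature y₀ =
      g.scalarCurvature (f y₀) - 2 * g.ricci (f y₀) (ν y₀) (ν y₀) / ε +
      (g.meanCurvature f hpb hfi ν y₀ ^ 2 -
        (g.inducedMetric f hpb hfi).normSq y₀ (g.secondFundamentalForm I' f ν y₀)) / ε := by
  haveI := (g.inducedMetric f hpb hfi).hasLeviCivita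
  classical
  have hf2 : ContMDiff I' I 2 f :=
    (IsSpacelikeImmersion.contMDiff_self hfi).of_le (by exact WithTop.coe_le_coe.2 le_top)
  have hdim : Module.finrank ℝ E = Module.finrank ℝ E' + 1 := by rw [h2, h3]
  -- an orthogonal basis `β` of `(T_{y₀} N, f^*g)`
  obtain ⟨e, he, hd⟩ := exists_isOrthoᵢ_basis (g.inducedMetric f hpb hfi) y₀
  have hfin : Module.finrank ℝ (TangentSpace I' y₀) = 2 := h2
  set β : Module.Basis (Fin 2) ℝ (TangentSpace I' y₀) := e.reindex (finCongr hfin) with hβdef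
  have hβapply : ∀ k, β k = e ((finCongr hfin).symm k) := fun k ↦ Module.Basis.reindex_apply _ _ _
  have hβ : ((g.inducedMetric f hpb hfi).toBilinForm y₀).IsOrthoᵢ β := by
    intro k l hkl
    simp only [Function.onFun, hβapply]
    exact he fun h ↦ hkl ((finCongr hfin).symm.injective h)
  have hdβ : ∀ k, (g.inducedMetric f hpb hfi).val y₀ (β k) (β k) ≠ 0 := fun k ↦ by
    rw [hβapply]; exact hd _
  -- the Gauss equation on the pair `(β₀, β₁)`
  have hG0 := gauss_equation_localFrame g hpb hfi (b' := β) (y₀ := y₀) hν hun hε hdim 0 1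
  simp only [localFrame_trivializationAt_self] at hG0
  -- the same, read in `T_{y₀} N` (the frame vectors at `y₀` are the `β k`)
  have hG : (g.inducedMetric f hpb hfi).val y₀
      ((g.inducedMetric f hpb hfi).riemann y₀ (β 0) (β 1) (β 1)) (β 0) =
      g.val (f y₀) (g.riemann (f y₀) (mfderiv I' I f y₀ (β 0)) (mfderiv I' I f y₀ (β 1))
        (mfderiv I' I f y₀ (β 1))) (mfderiv I' I f y₀ (β 0)) +
      (g.secondFundamentalForm I' f ν y₀ (β 0) (β 0) * g.secondFundamentalForm I' f ν y₀ (β 1) (β 1)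
        - g.secondFundamentalForm I' f ν y₀ (β 0) (β 1) *
          g.secondFundamentalForm I' f ν y₀ (β 1) (β 0)) / ε := hG0
  -- symmetry of `K`
  have hKs : g.secondFundamentalForm I' f ν y₀ (β 1) (β 0) =
      g.secondFundamentalForm I' f ν y₀ (β 0) (β 1) :=
    (secondFundamentalForm_symm_holds (g := g) (I' := I') hf2 hun.1
      (hν.of_le (by exact WithTop.coe_le_coe.2 le_top)) BoundarylessManifold.isInteriorPoint).eq _ _
  -- the scalar curvature of the surface
  have hSN := scalarCurvature_eq_of_isOrthoᵢ_two (g.inducedMetric f hpb hfi) y₀ β hβ (hdβ 0) (hdβ 1)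
  -- the adapted orthogonal basis `(df β₀, df β₁, ν)` of `T_{f y₀} M`
  have hn0 : ∀ k, g.val (f y₀) (mfderiv I' I f y₀ (β k)) (ν y₀) = 0 := fun k ↦ by
    rw [g.symm]; exact hun.1 y₀ (β k)
  have h01 : g.val (f y₀) (mfderiv I' I f y₀ (β 0)) (mfderiv I' I f y₀ (β 1)) = 0 :=
    hβ (show (0 : Fin 2) ≠ 1 by decide)
  have h10 : g.val (f y₀) (mfderiv I' I f y₀ (β 1)) (mfderiv I' I f y₀ (β 0)) = 0 :=
    hβ (show (1 : Fin 2) ≠ 0 by decide)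
  have hνε : g.val (f y₀) (ν y₀) (ν y₀) = ε := hun.2 y₀
  set v : Fin 3 → TangentSpace I (f y₀) :=
    ![mfderiv I' I f y₀ (β 0), mfderiv I' I f y₀ (β 1), ν y₀] with hv
  have hv0 : v 0 = mfderiv I' I f y₀ (β 0) := rfl
  have hv1 : v 1 = mfderiv I' I f y₀ (β 1) := rfl
  have hv2 : v 2 = ν y₀ := rfl
  have hvo : (g.toBilinForm (f y₀)).IsOrthoᵢ v := by
    intro k l hkl
    fin_cases k <;> fin_cases l <;> first
      | exact absurd rfl hkl
      | simp only [Function.onFun, hv0, hv1, hv2, Fin.zero_eta, Fin.mk_one, Fin.reduceFinMk,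
          toBilinForm_apply, h01, h10, hn0, g.symm (f y₀) (ν y₀) (mfderiv I' I f y₀ (β _))]
  have hvd : ∀ k, g.toBilinForm (f y₀) (v k) (v k) ≠ 0 := by
    intro k
    fin_cases k
    · simpa [hv0, toBilinForm_apply] using hdβ 0
    · simpa [hv1, toBilinForm_apply] using hdβ 1
    · simp only [hv2, Fin.reduceFinMk, toBilinForm_apply, hνε]; exact hε
  have hli : LinearIndependent ℝ v := LinearMap.linearIndependent_of_isOrthoᵢ hvo hvd
  haveI : FiniteDimensional ℝ (TangentSpace I (f y₀)) := inferInstanceAs (FiniteDimensional ℝ E)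
  have hcard : Fintype.card (Fin 3) = Module.finrank ℝ (TangentSpace I (f y₀)) := by
    show Fintype.card (Fin 3) = Module.finrank ℝ E
    rw [h3, Fintype.card_fin]
  set γ := basisOfLinearIndependentOfCardEqFinrank hli hcard with hγdef
  have hγ : ∀ k, γ k = v k := fun k ↦
    congrFun (coe_basisOfLinearIndependentOfCardEqFinrank hli hcard) k
  have hγo : (g.toBilinForm (f y₀)).IsOrthoᵢ γ := by
    intro k l hkl
    simp only [Function.onFun, hγ]
    exact hvo hkl
  have hSM := scalarCurvature_sub_ricci_eq_of_isOrthoᵢ_three g (f y₀) γ hγo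
    (by rw [hγ]; exact hvd 0) (by rw [hγ]; exact hvd 1) (by rw [hγ]; exact hvd 2)
  simp only [hγ, hv0, hv1, hv2, hνε] at hSM
  -- the metric coefficients `aₖ = (f^*g)(βₖ, βₖ) = g(df βₖ, df βₖ)`
  have ha : ∀ k, g.val (f y₀) (mfderiv I' I f y₀ (β k)) (mfderiv I' I f y₀ (β k)) =
      (g.inducedMetric f hpb hfi).val y₀ (β k) (β k) := fun k ↦ rfl
  rw [ha 0, ha 1] at hSM
  -- `H` and `|K|²` in the orthogonal frame
  have hH : g.meanCurvature f hpb hfi ν y₀ =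
      g.secondFundamentalForm I' f ν y₀ (β 0) (β 0) / (g.inducedMetric f hpb hfi).val y₀ (β 0) (β 0)
      + g.secondFundamentalForm I' f ν y₀ (β 1) (β 1) /
        (g.inducedMetric f hpb hfi).val y₀ (β 1) (β 1) := by
    rw [meanCurvature, trace_eq_sum_gram_inv _ y₀ β, gram_inv_of_isOrthoᵢ _ y₀ β hβ hdβ]
    simp only [Matrix.diagonal_apply, Fin.sum_univ_two, Fin.isValue, if_true, one_ne_zero,
      zero_ne_one, if_false, zero_mul, add_zero, zero_add]
    field_simp
  have hA := normSq_eq_sum_sq (g.inducedMetric f hpb hfi) y₀ β hβ hdβ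
    (g.secondFundamentalForm I' f ν y₀)
  simp only [Fin.sum_univ_two, Fin.isValue, hKs] at hA
  -- assemble
  rw [hSN, hH, hA]
  have hSM' : g.scalarCurvature (f y₀) =
      2 * g.val (f y₀) (g.riemann (f y₀) (mfderiv I' I f y₀ (β 0)) (mfderiv I' I f y₀ (β 1))
        (mfderiv I' I f y₀ (β 1))) (mfderiv I' I f y₀ (β 0)) /
        ((g.inducedMetric f hpb hfi).val y₀ (β 0) (β 0) *
          (g.inducedMetric f hpb hfi).val y₀ (β 1) (β 1)) +
      2 * g.ricci (f y₀) (ν y₀) (ν y₀) / ε := by linarith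
  rw [hSM', hG, hKs]
  have ha0 := hdβ 0
  have ha1 := hdβ 1
  field_simp
  ring

end Traced

end PseudoRiemannianMetric

end Literature.Geometry.Lorentzian

end
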